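import Summits.HodgeConjecture.CorCM.MultiFieldWeilSexticsDecicsTowers
import HarnessLib

/-!
# MULTI-FIELD WEIL ENGINE — SIMPLE FAMILIES: ANY NUMBER of SIMPLE CM threefolds (sextic fields `∋ k`, cubic tower) and of WEIL-TYPE CM fivefolds
# (decic fields `∋ k`, quintic tower), with NO hypothesis on the individual CM types — the Hodge conjecture for every product of copies, given ONLY
# Markman's fourfold and hyperbolic-sixfold theorems

Cell `pub-hodgecm2` (COR-CM), seat b30 gen 33 (2026-08-24); count-neutral own lane MULTI-FIELD WEIL ENGINE (stem `MultiFieldWeil*`), sequel of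
`CorCM/MultiFieldWeilCubicTower.lean` (Q3), `CorCM/MultiFieldWeilDecicTower.lean` (Q7) and `CorCM/MultiFieldWeilSexticsDecicsTowers.lean` (Q8, the capstone).  Theorems
only; no definition, no named fact, no `sorry`.  HONEST FRAMING: conditional on the displayed Markman binders only; `HC_CM` is NOT proved and not asserted.

WHY.  The tower headlines of gen 32 carry, besides the field hypotheses, ONE hypothesis on each CM type: exactly one member over `τ` for a threefold (`(1,2)`),
exactly two for a fivefold (`(2,3)`).  For a fixed VARIETY these are normalisations, not restrictions: a SIMPLE CM threefold over a sextic `K ⊇ k` has a type with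
one or two members over `τ` (it is not induced from `k`), and two members become one on passing to the conjugate structure `(Φ ∘ c_K, ι ∘ c_K, θ ∘ c_K)` on the SAME
variety (gen 31's `exists_realisation_card_eq_one`); likewise three members over `τ` of a decic type become two (gen 32's `exists_realisation_card_eq_two`).  Gen 32
did this for two and three varieties in `vec` form; this file does it ONCE for families of any length, in the engine's own indexing, by a slotwise change of structure
(`exists_realisations_of_forall_succ`: new dependent families `Φ', ι', θ'` on the same `A`, unchanged at the curve slot `0`).  The conclusions only mention the
varieties, so every tower headline acquires a form whose hypotheses on the threefold slots are `IsSimple` and nothing else, and on the fivefold slots the `k`-signature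
`(2,3)`/`(3,2)` and nothing else.

* §1 **`exists_realisations_of_forall_succ`** — reassembling slotwise choices of CM structures into dependent families over `Fin (r + 1)`.
* §2 **`hodgeConjectureFor_biproduct_comp_of_simpleThreefolds_of_cubicTower`** (+ dominated) — `E = A 0 ⊨ (k; {τ})` and ANY NUMBER of SIMPLE CM threefolds
  `T_m = A (m+1)` over sextic `K_m ∋ k`, each field with no `k`-embedding into the compositum of (the chosen images of) the earlier ones: the Hodge conjecture for EVERY
  product of copies, GIVEN ONLY `Markman2025_weilClasses_algebraic_abelianFourfold`.
* §3 **`hodgeConjectureFor_biproduct_comp_of_weilFivefolds_of_quinticTower`** (+ dominated) — the same for fivefolds over decic `K_m ∋ k` whose types have two OR three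
  members over `τ`, GIVEN ONLY `Markman2025_weilClasses_algebraic_hyperbolicSixfold`.
* §4 **`hodgeConjectureFor_biproduct_comp_of_simpleThreefolds_weilFivefolds_of_towers`** (+ dominated) — both together, in any order (the capstone Q8 with the type
  hypotheses replaced by `IsSimple` on the sextic slots and the `k`-signature on the decic slots).

[cite: Markman2025SurveySecant, Thm. 1.2] [cite: Markman2025SecantWeil, Thm 1.5.1] [cite: Shimura1998, §8.2 Prop. 26, §8.4, §18.2 Lemma (i)]
[cite: Lang2002, V §1 Prop. 1.2, VI §1 Thm. 1.1, Cor. 1.6 and V §2 Thm. 2.8]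

## References
* [Markman2025SurveySecant] E. Markman, arXiv:2509.23403, Thm. 1.2.  [Markman2025SecantWeil] E. Markman, arXiv:2502.03415, Thm 1.5.1.  [Shimura1998] G. Shimura,
  *Abelian varieties with complex multiplication and modular functions*, §8.2 Prop. 26, §8.4, §18.2 Lemma (i).  [Lang2002] S. Lang, *Algebra*, GTM 211, V §1–§2, VI §1.
-/

noncomputable section

open CategoryTheory CategoryTheory.Limits NumberField IntermediateField

namespace Summit.HodgeConjecture.CorCM.MultiFieldWeil

open Finset
open Literature.AlgebraicGeometry Literature.AlgebraicGeometry.Motives Literature.AlgebraicGeometry.HodgeTheory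
open Literature.AlgebraicGeometry.ComplexMultiplication (IsCMTypeRealisation)
open Literature.AlgebraicTopology.SingularHomology
open Literature.NumberTheory.ComplexMultiplication

open scoped Classical

section Engine

variable {I : Type} {r : ℕ} {Kf : I → Type} [∀ i, Field (Kf i)] [∀ i, NumberField (Kf i)] [∀ i, IsCMField (Kf i)]
  {i₀ : I} {is : Fin r → I} {τ : Kf i₀ →+* ℂ}
  {A : Fin (r + 1) → AbelianVariety ℂ} {Φ : ∀ j : Fin (r + 1), CMType (Kf (mfSlots i₀ is j))}
  {ι : ∀ j, 𝓞 (Kf (mfSlots i₀ is j)) →+* End (A j)}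
  {θ : ∀ j, Kf (mfSlots i₀ is j) →+* Module.End ℂ (complexBetti (A j).X 1)}

/-! ## §1 Reassembling slotwise changes of CM structure -/

omit [∀ i, IsCMField (Kf i)] in
/-- **Slotwise change of CM structure on the same varieties.**  If every non-curve slot `A (m+1)` admits SOME realisation `(Φ'_m, ι'_m, θ'_m)` over its field
`Kf (is m)` with a property `Q m Φ'_m`, then there are dependent families `Φ', ι', θ'` over `Fin (r + 1)` realised on the same family `A`, equal to the given
structure at the curve slot `0` and with `Q m (Φ' (m+1))` for every `m` (`Fin.cons` of the choices). [folklore] -/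
theorem exists_realisations_of_forall_succ (hA : ∀ j, IsCMTypeRealisation (Φ j) (A j) (ι j) (θ j))
    (Q : ∀ m : Fin r, CMType (Kf (is m)) → Prop)
    (h : ∀ m : Fin r, ∃ (Φ' : CMType (Kf (is m))) (ι' : 𝓞 (Kf (is m)) →+* End (A m.succ))
      (θ' : Kf (is m) →+* Module.End ℂ (complexBetti (A m.succ).X 1)), IsCMTypeRealisation Φ' (A m.succ) ι' θ' ∧ Q m Φ') :
    ∃ (Φ' : ∀ j : Fin (r + 1), CMType (Kf (mfSlots i₀ is j))) (ι' : ∀ j, 𝓞 (Kf (mfSlots i₀ is j)) →+* End (A j))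
      (θ' : ∀ j, Kf (mfSlots i₀ is j) →+* Module.End ℂ (complexBetti (A j).X 1)),
      (∀ j, IsCMTypeRealisation (Φ' j) (A j) (ι' j) (θ' j)) ∧ Φ' 0 = Φ 0 ∧ ∀ m : Fin r, Q m (Φ' m.succ) := by
  choose Φ'' ι'' θ'' hA'' hQ using h
  refine ⟨Fin.cons (Φ 0) Φ'', Fin.cons (ι 0) ι'', Fin.cons (θ 0) θ'', Fin.cases (hA 0) (fun m => ?_), rfl, fun m => ?_⟩
  · exact hQ m
  · exact hA'' m

/-! ## §2 Any number of SIMPLE CM threefolds over a cubic tower of sextic CM fields -/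

/-- **ANY NUMBER OF SIMPLE CM THREEFOLDS OVER A CUBIC TOWER OF SEXTIC CM FIELDS — given ONLY Markman's fourfold theorem.**  `E = A 0 ⊨ (k; {τ})`, `k = Kf i₀`
imaginary quadratic; `T_m = A (m+1) ⊨ (K_m; Φ (m+1))` SIMPLE abelian threefolds over SEXTIC `K_m = Kf (is m) ⊇ im m (k)` — NO hypothesis on the types; a family `s₀`
of `τ`-embeddings such that for every `m` NO `τ`-embedding of `K_m` takes its values in `ℚ(τk) · s₀_0(K_0) ⋯ s₀_{m−1}(K_{m−1})` (no `k`-embedding of `K_m` into the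
compositum of the earlier fields).  Then the Hodge conjecture holds for EVERY product of copies `⨁_j A (κ j)` — `E^a × T_0^{b_0} × ⋯ × T_{r−1}^{b_{r−1}}` — GIVEN ONLY
`Markman2025_weilClasses_algebraic_abelianFourfold`.  (The types are normalised slot by slot to one member over `τ` on the same varieties —
`card_filter_mem_eq_one_or_two_of_isSimple`, `exists_realisation_card_eq_one` — then `hodgeConjectureFor_biproduct_comp_of_sextics_of_cubicTower`.)  `HC_CM` is NOT
asserted. [cite: Markman2025SurveySecant, Thm. 1.2] [cite: Shimura1998, §8.2 Prop. 26, §8.4, §18.2 Lemma (i)] [cite: Lang2002, VI §1 Thm. 1.1, Cor. 1.6 and V §2 Thm. 2.8] -/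
theorem hodgeConjectureFor_biproduct_comp_of_simpleThreefolds_of_cubicTower (hW4 : Markman2025_weilClasses_algebraic_abelianFourfold)
    {N : ℕ} (κ : Fin N → Fin (r + 1)) (h2 : Module.finrank ℚ (Kf i₀) = 2) (h6 : ∀ m : Fin r, Module.finrank ℚ (Kf (is m)) = 6)
    (im : ∀ m : Fin r, Kf i₀ →+* Kf (is m)) (hA : ∀ j, IsCMTypeRealisation (Φ j) (A j) (ι j) (θ j)) (hΨ : ∀ σ : Kf i₀ →+* ℂ, σ ∈ (Φ 0).1 ↔ σ = τ)
    (hS : ∀ m : Fin r, (A m.succ).IsSimple) (s₀ : ∀ m : Fin r, Kf (is m) →+* ℂ) (hs₀ : ∀ m, (s₀ m).comp (im m) = τ)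
    (htower : ∀ (m : Fin r) (φ : Kf (is m) →+* ℂ), φ.comp (im m) = τ →
      ¬ Set.range φ ⊆ (↑(adjoin ℚ (Set.range τ) ⊔ adjoin ℚ (⋃ j : {j : Fin r // j < m}, Set.range (s₀ j.1))) : Set ℂ)) :
    HodgeConjectureFor (⨁ fun j => A (κ j)).dim (⨁ fun j => A (κ j)).X := by
  obtain ⟨Φ', ι', θ', hA', h0, h1⟩ := exists_realisations_of_forall_succ hA
    (fun m Φ' => (Finset.univ.filter fun s : Kf (is m) →+* ℂ => s.comp (im m) = τ ∧ s ∈ Φ'.1).card = 1)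
    (fun m => exists_realisation_card_eq_one (h6 m) h2 (im m) (hA m.succ) τ
      (card_filter_mem_eq_one_or_two_of_isSimple (h6 m) h2 (im m) (hA m.succ) (hS m) τ))
  have hΨ' : ∀ σ : Kf i₀ →+* ℂ, σ ∈ (Φ' 0).1 ↔ σ = τ := by rw [h0]; exact hΨ
  exact hodgeConjectureFor_biproduct_comp_of_sextics_of_cubicTower hW4 κ h2 h6 im hA' hΨ' h1 s₀ hs₀ htower

/-- **Dominated form** of `hodgeConjectureFor_biproduct_comp_of_simpleThreefolds_of_cubicTower`: everything dominated by a product of copies of `E` and of the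
simple threefolds `T_m`. [cite: Markman2025SurveySecant, Thm. 1.2] [cite: MumfordAV1970, §19 Thm. 1 and p. 169] -/
theorem hodgeConjectureFor_of_avDominatedBy_comp_of_simpleThreefolds_of_cubicTower (hW4 : Markman2025_weilClasses_algebraic_abelianFourfold)
    {N : ℕ} (κ : Fin N → Fin (r + 1)) (h2 : Module.finrank ℚ (Kf i₀) = 2) (h6 : ∀ m : Fin r, Module.finrank ℚ (Kf (is m)) = 6)
    (im : ∀ m : Fin r, Kf i₀ →+* Kf (is m)) (hA : ∀ j, IsCMTypeRealisation (Φ j) (A j) (ι j) (θ j)) (hΨ : ∀ σ : Kf i₀ →+* ℂ, σ ∈ (Φ 0).1 ↔ σ = τ)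
    (hS : ∀ m : Fin r, (A m.succ).IsSimple) (s₀ : ∀ m : Fin r, Kf (is m) →+* ℂ) (hs₀ : ∀ m, (s₀ m).comp (im m) = τ)
    (htower : ∀ (m : Fin r) (φ : Kf (is m) →+* ℂ), φ.comp (im m) = τ →
      ¬ Set.range φ ⊆ (↑(adjoin ℚ (Set.range τ) ⊔ adjoin ℚ (⋃ j : {j : Fin r // j < m}, Set.range (s₀ j.1))) : Set ℂ))
    {X : AbelianVariety ℂ} (hX : Domination.AVDominatedBy X (⨁ fun j => A (κ j))) : HodgeConjectureFor X.dim X.X :=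
  Domination.hodgeConjectureFor_of_avDominatedBy
    (hodgeConjectureFor_biproduct_comp_of_simpleThreefolds_of_cubicTower hW4 κ h2 h6 im hA hΨ hS s₀ hs₀ htower) hX

/-! ## §3 Any number of WEIL-TYPE CM fivefolds over a quintic tower of decic CM fields -/

/-- **ANY NUMBER OF WEIL-TYPE CM FIVEFOLDS OVER A QUINTIC TOWER OF DECIC CM FIELDS — given ONLY Markman's hyperbolic-sixfold theorem.**  `E = A 0 ⊨ (k; {τ})`,
`k = Kf i₀` imaginary quadratic; `F_m = A (m+1) ⊨ (K_m; Φ (m+1))` abelian fivefolds over DECIC `K_m = Kf (is m) ⊇ im m (k)` whose types have TWO OR THREE members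
over `τ` (`k`-signature `(2,3)` or `(3,2)`: Weil type — the only hypothesis on the types); a family `s₀` of `τ`-embeddings such that for every `m` NO `τ`-embedding of
`K_m` takes its values in `ℚ(τk) · s₀_0(K_0) ⋯ s₀_{m−1}(K_{m−1})`.  Then the Hodge conjecture holds for EVERY product of copies `⨁_j A (κ j)`, GIVEN ONLY
`Markman2025_weilClasses_algebraic_hyperbolicSixfold` (three members ↦ two on the conjugate structure, `exists_realisation_card_eq_two`, then
`hodgeConjectureFor_biproduct_comp_of_decics_of_quinticTower`).  The `(1,4)`-fivefolds are NOT covered.  `HC_CM` is NOT asserted. [cite: Markman2025SecantWeil, Thm 1.5.1]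
[cite: Shimura1998, §18.2 Lemma (i)] [cite: Lang2002, VI §1 Thm. 1.1, Cor. 1.6 and V §2 Thm. 2.8] -/
theorem hodgeConjectureFor_biproduct_comp_of_weilFivefolds_of_quinticTower (hM6 : Markman2025_weilClasses_algebraic_hyperbolicSixfold)
    {N : ℕ} (κ : Fin N → Fin (r + 1)) (h2 : Module.finrank ℚ (Kf i₀) = 2) (h10 : ∀ m : Fin r, Module.finrank ℚ (Kf (is m)) = 10)
    (im : ∀ m : Fin r, Kf i₀ →+* Kf (is m)) (hA : ∀ j, IsCMTypeRealisation (Φ j) (A j) (ι j) (θ j)) (hΨ : ∀ σ : Kf i₀ →+* ℂ, σ ∈ (Φ 0).1 ↔ σ = τ)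
    (h23 : ∀ m : Fin r, (Finset.univ.filter fun s : Kf (is m) →+* ℂ => s.comp (im m) = τ ∧ s ∈ (Φ m.succ).1).card = 2 ∨
      (Finset.univ.filter fun s : Kf (is m) →+* ℂ => s.comp (im m) = τ ∧ s ∈ (Φ m.succ).1).card = 3)
    (s₀ : ∀ m : Fin r, Kf (is m) →+* ℂ) (hs₀ : ∀ m, (s₀ m).comp (im m) = τ)
    (htower : ∀ (m : Fin r) (φ : Kf (is m) →+* ℂ), φ.comp (im m) = τ →
      ¬ Set.range φ ⊆ (↑(adjoin ℚ (Set.range τ) ⊔ adjoin ℚ (⋃ j : {j : Fin r // j < m}, Set.range (s₀ j.1))) : Set ℂ)) :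
    HodgeConjectureFor (⨁ fun j => A (κ j)).dim (⨁ fun j => A (κ j)).X := by
  obtain ⟨Φ', ι', θ', hA', h0, h2'⟩ := exists_realisations_of_forall_succ hA
    (fun m Φ' => (Finset.univ.filter fun s : Kf (is m) →+* ℂ => s.comp (im m) = τ ∧ s ∈ Φ'.1).card = 2)
    (fun m => exists_realisation_card_eq_two (h10 m) h2 (im m) (hA m.succ) τ (h23 m))
  have hΨ' : ∀ σ : Kf i₀ →+* ℂ, σ ∈ (Φ' 0).1 ↔ σ = τ := by rw [h0]; exact hΨ
  exact hodgeConjectureFor_biproduct_comp_of_decics_of_quinticTower hM6 κ h2 h10 im hA' hΨ' h2' s₀ hs₀ htower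

/-- **Dominated form** of `hodgeConjectureFor_biproduct_comp_of_weilFivefolds_of_quinticTower`. [cite: Markman2025SecantWeil, Thm 1.5.1]
[cite: MumfordAV1970, §19 Thm. 1 and p. 169] -/
theorem hodgeConjectureFor_of_avDominatedBy_comp_of_weilFivefolds_of_quinticTower (hM6 : Markman2025_weilClasses_algebraic_hyperbolicSixfold)
    {N : ℕ} (κ : Fin N → Fin (r + 1)) (h2 : Module.finrank ℚ (Kf i₀) = 2) (h10 : ∀ m : Fin r, Module.finrank ℚ (Kf (is m)) = 10)
    (im : ∀ m : Fin r, Kf i₀ →+* Kf (is m)) (hA : ∀ j, IsCMTypeRealisation (Φ j) (A j) (ι j) (θ j)) (hΨ : ∀ σ : Kf i₀ →+* ℂ, σ ∈ (Φ 0).1 ↔ σ = τ)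
    (h23 : ∀ m : Fin r, (Finset.univ.filter fun s : Kf (is m) →+* ℂ => s.comp (im m) = τ ∧ s ∈ (Φ m.succ).1).card = 2 ∨
      (Finset.univ.filter fun s : Kf (is m) →+* ℂ => s.comp (im m) = τ ∧ s ∈ (Φ m.succ).1).card = 3)
    (s₀ : ∀ m : Fin r, Kf (is m) →+* ℂ) (hs₀ : ∀ m, (s₀ m).comp (im m) = τ)
    (htower : ∀ (m : Fin r) (φ : Kf (is m) →+* ℂ), φ.comp (im m) = τ →
      ¬ Set.range φ ⊆ (↑(adjoin ℚ (Set.range τ) ⊔ adjoin ℚ (⋃ j : {j : Fin r // j < m}, Set.range (s₀ j.1))) : Set ℂ))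
    {X : AbelianVariety ℂ} (hX : Domination.AVDominatedBy X (⨁ fun j => A (κ j))) : HodgeConjectureFor X.dim X.X :=
  Domination.hodgeConjectureFor_of_avDominatedBy
    (hodgeConjectureFor_biproduct_comp_of_weilFivefolds_of_quinticTower hM6 κ h2 h10 im hA hΨ h23 s₀ hs₀ htower) hX

/-! ## §4 Simple threefolds and Weil-type fivefolds together -/

/-- **SIMPLE CM THREEFOLDS AND WEIL-TYPE CM FIVEFOLDS TOGETHER — given ONLY Markman's two theorems.**  `E = A 0 ⊨ (k; {τ})`, `k = Kf i₀` imaginary quadratic;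
for `m : Fin r`, `K_m = Kf (is m) ⊇ im m (k)` of degree `2 n_m`, `n_m ∈ {3, 5}`, and `A (m+1) ⊨ (K_m; Φ (m+1))` is, when `n_m = 3`, a SIMPLE abelian threefold
(nothing assumed on its type) and, when `n_m = 5`, a fivefold whose type has two or three members over `τ` (Weil type); ONE family `s₀` of `τ`-embeddings such that for
every `m` NO `τ`-embedding of `K_m` has image inside `ℚ(τk) · ∏_{j < m, n_j = n_m} s₀_j(K_j)` (no `k`-embedding of `K_m` into the compositum of the EARLIER fields OF THE
SAME DEGREE).  Then the Hodge conjecture holds for EVERY product of copies `⨁_j A (κ j)` — any `E^a × ∏ T_m^{b_m} × ∏ F_m^{c_m}` — GIVEN ONLY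
`Markman2025_weilClasses_algebraic_abelianFourfold` and `Markman2025_weilClasses_algebraic_hyperbolicSixfold` (slotwise normalisation, then the capstone
`hodgeConjectureFor_biproduct_comp_of_sexticsDecics_of_towers` with `p_m = 1` resp. `2`).  `HC_CM` is NOT asserted. [cite: Markman2025SurveySecant, Thm. 1.2]
[cite: Markman2025SecantWeil, Thm 1.5.1] [cite: Shimura1998, §8.2 Prop. 26, §8.4, §18.2 Lemma (i)] [cite: Lang2002, VI §1 Thm. 1.1, Cor. 1.6 and V §2 Thm. 2.8] -/
theorem hodgeConjectureFor_biproduct_comp_of_simpleThreefolds_weilFivefolds_of_towers (hW4 : Markman2025_weilClasses_algebraic_abelianFourfold)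
    (hM6 : Markman2025_weilClasses_algebraic_hyperbolicSixfold) (n : Fin r → ℕ) (hn : ∀ m, n m = 3 ∨ n m = 5)
    {N : ℕ} (κ : Fin N → Fin (r + 1)) (h2 : Module.finrank ℚ (Kf i₀) = 2) (hdeg : ∀ m : Fin r, Module.finrank ℚ (Kf (is m)) = 2 * n m)
    (im : ∀ m : Fin r, Kf i₀ →+* Kf (is m)) (hA : ∀ j, IsCMTypeRealisation (Φ j) (A j) (ι j) (θ j)) (hΨ : ∀ σ : Kf i₀ →+* ℂ, σ ∈ (Φ 0).1 ↔ σ = τ)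
    (hS : ∀ m : Fin r, n m = 3 → (A m.succ).IsSimple)
    (h23 : ∀ m : Fin r, n m = 5 → (Finset.univ.filter fun s : Kf (is m) →+* ℂ => s.comp (im m) = τ ∧ s ∈ (Φ m.succ).1).card = 2 ∨
      (Finset.univ.filter fun s : Kf (is m) →+* ℂ => s.comp (im m) = τ ∧ s ∈ (Φ m.succ).1).card = 3)
    (s₀ : ∀ m : Fin r, Kf (is m) →+* ℂ) (hs₀ : ∀ m, (s₀ m).comp (im m) = τ)
    (htower : ∀ (m : Fin r) (φ : Kf (is m) →+* ℂ), φ.comp (im m) = τ →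
      ¬ Set.range φ ⊆ (↑(adjoin ℚ (Set.range τ) ⊔
        adjoin ℚ (⋃ j ∈ (Finset.univ.filter fun j : Fin r => n j = n m).filter (· < m), Set.range (s₀ j))) : Set ℂ)) :
    HodgeConjectureFor (⨁ fun j => A (κ j)).dim (⨁ fun j => A (κ j)).X := by
  obtain ⟨Φ', ι', θ', hA', h0, hp⟩ := exists_realisations_of_forall_succ hA
    (fun m Φ' => (Finset.univ.filter fun s : Kf (is m) →+* ℂ => s.comp (im m) = τ ∧ s ∈ Φ'.1).card = if n m = 3 then 1 else 2)
    (fun m => by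
      rcases hn m with h3 | h5
      · obtain ⟨Φ', ι', θ', hT, h1⟩ := exists_realisation_card_eq_one (by rw [hdeg m, h3]) h2 (im m) (hA m.succ) τ
          (card_filter_mem_eq_one_or_two_of_isSimple (by rw [hdeg m, h3]) h2 (im m) (hA m.succ) (hS m h3) τ)
        exact ⟨Φ', ι', θ', hT, by rw [h1, if_pos h3]⟩
      · obtain ⟨Φ', ι', θ', hF, h2'⟩ := exists_realisation_card_eq_two (by rw [hdeg m, h5]) h2 (im m) (hA m.succ) τ (h23 m h5)
        exact ⟨Φ', ι', θ', hF, by rw [h2', h5, if_neg (by norm_num)]⟩)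
  have hΨ' : ∀ σ : Kf i₀ →+* ℂ, σ ∈ (Φ' 0).1 ↔ σ = τ := by rw [h0]; exact hΨ
  exact hodgeConjectureFor_biproduct_comp_of_sexticsDecics_of_towers hW4 hM6 n (fun m => if n m = 3 then 1 else 2)
    (fun m => by
      rcases hn m with h3 | h5
      · exact Or.inl ⟨h3, if_pos h3⟩
      · exact Or.inr ⟨h5, by rw [h5, if_neg (by norm_num)]⟩)
    κ h2 hdeg im hA' hΨ' hp s₀ hs₀ htower

/-- **Dominated form** of `hodgeConjectureFor_biproduct_comp_of_simpleThreefolds_weilFivefolds_of_towers`. [cite: Markman2025SurveySecant, Thm. 1.2]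
[cite: Markman2025SecantWeil, Thm 1.5.1] [cite: MumfordAV1970, §19 Thm. 1 and p. 169] -/
theorem hodgeConjectureFor_of_avDominatedBy_comp_of_simpleThreefolds_weilFivefolds_of_towers (hW4 : Markman2025_weilClasses_algebraic_abelianFourfold)
    (hM6 : Markman2025_weilClasses_algebraic_hyperbolicSixfold) (n : Fin r → ℕ) (hn : ∀ m, n m = 3 ∨ n m = 5)
    {N : ℕ} (κ : Fin N → Fin (r + 1)) (h2 : Module.finrank ℚ (Kf i₀) = 2) (hdeg : ∀ m : Fin r, Module.finrank ℚ (Kf (is m)) = 2 * n m)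
    (im : ∀ m : Fin r, Kf i₀ →+* Kf (is m)) (hA : ∀ j, IsCMTypeRealisation (Φ j) (A j) (ι j) (θ j)) (hΨ : ∀ σ : Kf i₀ →+* ℂ, σ ∈ (Φ 0).1 ↔ σ = τ)
    (hS : ∀ m : Fin r, n m = 3 → (A m.succ).IsSimple)
    (h23 : ∀ m : Fin r, n m = 5 → (Finset.univ.filter fun s : Kf (is m) →+* ℂ => s.comp (im m) = τ ∧ s ∈ (Φ m.succ).1).card = 2 ∨
      (Finset.univ.filter fun s : Kf (is m) →+* ℂ => s.comp (im m) = τ ∧ s ∈ (Φ m.succ).1).card = 3)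
    (s₀ : ∀ m : Fin r, Kf (is m) →+* ℂ) (hs₀ : ∀ m, (s₀ m).comp (im m) = τ)
    (htower : ∀ (m : Fin r) (φ : Kf (is m) →+* ℂ), φ.comp (im m) = τ →
      ¬ Set.range φ ⊆ (↑(adjoin ℚ (Set.range τ) ⊔
        adjoin ℚ (⋃ j ∈ (Finset.univ.filter fun j : Fin r => n j = n m).filter (· < m), Set.range (s₀ j))) : Set ℂ))
    {X : AbelianVariety ℂ} (hX : Domination.AVDominatedBy X (⨁ fun j => A (κ j))) : HodgeConjectureFor X.dim X.X :=
  Domination.hodgeConjectureFor_of_avDominatedBy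
    (hodgeConjectureFor_biproduct_comp_of_simpleThreefolds_weilFivefolds_of_towers hW4 hM6 n hn κ h2 hdeg im hA hΨ hS h23 s₀ hs₀ htower) hX

end Engine

end Summit.HodgeConjecture.CorCM.MultiFieldWeil

end
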